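import Mathlib.Analysis.Calculus.Deriv.Basic
import Mathlib.Analysis.Calculus.FDeriv.Add
import Mathlib.Topology.Order.IntermediateValue
import Mathlib.Topology.EMetricSpace.Lipschitz
import HarnessLib

/-!
# An implicit function theorem without continuous differentiability (Halkin; Chodosh–Shlapentokh-Rothman, Thm. 15.1)

Topic `Literature/Analysis/Calculus`. This file proves the one-dimensional implicit function
theorem used in the last step (§13.4, "Arranging for a constant Klein–Gordon mass") of
O. Chodosh, Y. Shlapentokh-Rothman, *Time-periodic Einstein–Klein–Gordon bifurcations of Kerr*,
Comm. Math. Phys. 356 (2017) 1155–1250, where it is stated and proved as Thm. 15.1 (appendix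
"An implicit function theorem for Lipschitz functions", p. 61 of arXiv:1510.08025), with the
attribution "The following version of the implicit function theorem is proven in [Halkin,
*Implicit functions and optimization problems without continuous differentiability of the data*,
SIAM J. Control 12 (1974) 229–236]":

> **Theorem 15.1.** Suppose that `f(x, y) : {(x, y) : x ∈ (−1, 1), y ∈ [0, 1)} → ℝ` is Lipschitz
> and differentiable at `(0, 0)` with `f(0, 0) = 0` and `∂ₓf(0, 0) ≠ 0`. Then, for some `η₀ > 0`,
> there is a function `X : [0, η₀) → (−1, 1)`, so that `X(0) = 0`, `f(X(y), y) = 0` for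
> `y ∈ [0, η₀)`, and so that `X` is differentiable at `0`.

It is a node of the decomposition of the barrier fact
`Literature.Barriers.FinalStateConjecture.HairyKerrBifurcation` (CSR Thm. 1.1) recorded in
`Literature/Barriers/FinalStateConjecture/HairyKerrBifurcation.lean`: Thm. 1.1 is obtained from
the `δ`-dependent-mass family of CSR Thm. 13.1 by solving `μ²(a(δ), M(a(δ)), δ) = const` for the
Kerr parameter `a(δ)` with exactly this theorem (CSR §13.4, pp. 58–59).

## What is proved

* `Literature.Analysis.Calculus.hasDerivWithinAt_implicitFunction` — the general form behind the printed proof: if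
  `f : ℝ × ℝ → ℝ` vanishes at `(0, 0)`, is differentiable at `(0, 0)` within `U ×ˢ s` (`U` a
  neighbourhood of `0`, `s` any parameter set) with `∂ₓf(0,0) = f'(1, 0) ≠ 0`, and `x ↦ f(x, y)`
  is continuous on `U` for `y ∈ s` near `0`, then there is `X : ℝ → ℝ` with `X 0 = 0`, `X y ∈ U`
  for all `y`, `f(X y, y) = 0` for `y ∈ s` near `0`, and `X` has the one-sided/within-`s`
  derivative `−∂_yf(0,0)/∂ₓf(0,0)` at `0`. Only continuity in `x` (not the Lipschitz property) is
  used, exactly as in the printed proof, where the Brouwer fixed point theorem in dimension one is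
  the intermediate value theorem (`intermediate_value_Icc`).
* `Literature.Analysis.Calculus.exists_implicitFunction_of_lipschitzOnWith` — Thm. 15.1 as printed (Lipschitz on
  `(−1, 1) × [0, 1)`), with the derivative of `X` at `0` made explicit.

Proof (CSR p. 61, made uniform): with `c = ∂ₓf(0,0) > 0` (else replace `f` by `−f`) and
`d = ∂_yf(0,0)`, differentiability gives `|f(x,y) − cx − dy| ≤ (c/4) max(|x|,|y|)` on a box
`max(|x|,|y|) < ρ₁` inside `U ×ˢ s`; for `x₀ < ρ₁` and `|y|` small, `f(x₀, y) > 0 > f(−x₀, y)`,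
so `f(·, y)` has a zero `X(y) ∈ [−x₀, x₀]`; the same inequality at `(X(y), y)` gives
`|X(y)| ≤ C|y|`, and then the little-`o` form of differentiability at `(0,0)` along
`y ↦ (X(y), y)` gives `X(y) = −(d/c) y + o(y)`.

Mathlib has the implicit function theorem only for strictly differentiable maps
(`HasStrictFDerivAt.implicitFunction`, `ImplicitFunctionData`); the point of Halkin's theorem
is that differentiability at the single point `(0, 0)` (plus continuity) suffices for an
implicit function differentiable at that point.

## References

* O. Chodosh, Y. Shlapentokh-Rothman, *Time-periodic Einstein–Klein–Gordon bifurcations of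
  Kerr*, Comm. Math. Phys. 356 (2017) 1155–1250, arXiv:1510.08025: Thm. 15.1 (p. 61) and §13.4
  (pp. 58–59). [ChodoshShlapentokhrothman2017]
* H. Halkin, *Implicit functions and optimization problems without continuous differentiability
  of the data*, SIAM J. Control 12 (1974) 229–236 (the source of Thm. 15.1 according to CSR; not
  consulted here).
-/

open Set Filter Topology Asymptotics

noncomputable section

namespace Literature.Analysis.Calculus

/-- A continuous linear functional on `ℝ × ℝ` is `(x, y) ↦ c x + d y` with `c = f'(1, 0)`,
`d = f'(0, 1)`. [folklore] -/
theorem continuousLinearMap_prod_apply_eq (f' : ℝ × ℝ →L[ℝ] ℝ) (p : ℝ × ℝ) :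
    f' p = f' (1, 0) * p.1 + f' (0, 1) * p.2 := by
  have hp : p = p.1 • ((1 : ℝ), (0 : ℝ)) + p.2 • ((0 : ℝ), (1 : ℝ)) := by ext <;> simp
  conv_lhs => rw [hp]
  rw [map_add, map_smul, map_smul, smul_eq_mul, smul_eq_mul]
  ring

/-- The implicit function theorem at a point of mere differentiability, positive-slope case
(the printed normalisation `∂ₓf(0,0) = 1` up to scaling): see
`hasDerivWithinAt_implicitFunction`. Chodosh–Shlapentokh-Rothman, CMP 356 (2017), proof of
Thm. 15.1 (p. 61). [cite: ChodoshShlapentokhrothman2017, Thm. 15.1 (proof)] -/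
theorem hasDerivWithinAt_implicitFunction_of_pos {f : ℝ × ℝ → ℝ} {f' : ℝ × ℝ →L[ℝ] ℝ}
    {U s : Set ℝ} (hU : U ∈ 𝓝 (0 : ℝ))
    (hc : ∀ᶠ y in 𝓝[s] 0, ContinuousOn (fun x ↦ f (x, y)) U)
    (hd : HasFDerivWithinAt f f' (U ×ˢ s) (0, 0)) (h0 : f (0, 0) = 0) (hx : 0 < f' (1, 0)) :
    ∃ X : ℝ → ℝ, X 0 = 0 ∧ (∀ y, X y ∈ U) ∧ (∀ᶠ y in 𝓝[s] 0, f (X y, y) = 0) ∧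
      HasDerivWithinAt X (-(f' (0, 1)) / f' (1, 0)) s 0 := by
  -- notation: `c = ∂ₓ f (0,0) > 0`, `d = ∂_y f (0,0)`
  set c := f' (1, 0) with hc_def
  set d := f' (0, 1) with hd_def
  have hlin : ∀ p : ℝ × ℝ, f' p = c * p.1 + d * p.2 := continuousLinearMap_prod_apply_eq f'
  -- the little-o estimate of differentiability at `(0,0)` within `U ×ˢ s`
  have hlo := hd.isLittleO
  have hbound : ∀ {ε : ℝ}, 0 < ε →
      ∀ᶠ p in 𝓝[U ×ˢ s] (0, 0), |f p - (c * p.1 + d * p.2)| ≤ ε * ‖p‖ := by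
    intro ε hε
    have h0' : f 0 = 0 := h0
    filter_upwards [hlo.def hε] with p hp
    simpa [h0, h0', hlin p, Real.norm_eq_abs, Prod.mk_zero_zero, sub_zero, map_zero] using hp
  -- Step 0: radii. `ball 0 ρ ⊆ U`; the `c/4`-estimate on `‖p‖ < ρ₁`; continuity for `|y| < ρ₂`.
  obtain ⟨ρ, hρ, hρU⟩ : ∃ ρ > 0, Metric.ball (0 : ℝ) ρ ⊆ U := Metric.mem_nhds_iff.mp hU
  obtain ⟨ρ₁, hρ₁, H₁⟩ : ∃ ρ₁ > 0, ∀ p : ℝ × ℝ, ‖p‖ < ρ₁ → p ∈ U ×ˢ s →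
      |f p - (c * p.1 + d * p.2)| ≤ c / 4 * ‖p‖ := by
    obtain ⟨ρ₁, hρ₁, H⟩ := Metric.eventually_nhds_iff.mp
      (eventually_nhdsWithin_iff.mp (hbound (by positivity : 0 < c / 4)))
    exact ⟨ρ₁, hρ₁, fun p hp hps ↦ H (by rwa [Prod.mk_zero_zero, dist_zero_right]) hps⟩
  obtain ⟨ρ₂, hρ₂, H₂⟩ : ∃ ρ₂ > 0, ∀ y : ℝ, |y| < ρ₂ → y ∈ s →
      ContinuousOn (fun x ↦ f (x, y)) U := by
    obtain ⟨ρ₂, hρ₂, H⟩ := Metric.eventually_nhds_iff.mp (eventually_nhdsWithin_iff.mp hc)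
    exact ⟨ρ₂, hρ₂, fun y hy hys ↦ H (by simpa using hy) hys⟩
  -- the abscissa `x₀` of the two comparison points `(± x₀, y)`
  set x₀ := min ρ ρ₁ / 2 with hx₀_def
  have hx₀ : 0 < x₀ := by positivity
  have hx₀ρ : x₀ < ρ := by
    have : min ρ ρ₁ ≤ ρ := min_le_left _ _
    rw [hx₀_def]; linarith
  have hx₀ρ₁ : x₀ < ρ₁ := by
    have : min ρ ρ₁ ≤ ρ₁ := min_le_right _ _
    rw [hx₀_def]; linarith
  have hIccU : Icc (-x₀) x₀ ⊆ U := fun x hx ↦ hρU (by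
    rw [Metric.mem_ball, dist_zero_right, Real.norm_eq_abs, abs_lt]
    exact ⟨by linarith [hx.1], by linarith [hx.2]⟩)
  -- the range `|y| < y₁` of parameters for which the zero is produced
  set y₁ := min (min x₀ ρ₂) (3 * c * x₀ / (4 * (|d| + 1))) with hy₁_def
  have hy₁ : 0 < y₁ := by positivity
  have hy₁x₀ : y₁ ≤ x₀ := (min_le_left _ _).trans (min_le_left _ _)
  have hy₁ρ₂ : y₁ ≤ ρ₂ := (min_le_left _ _).trans (min_le_right _ _)
  have hy₁d : ∀ {y : ℝ}, |y| < y₁ → |d| * |y| < 3 * c / 4 * x₀ := by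
    intro y hy
    have h1 : |y| < 3 * c * x₀ / (4 * (|d| + 1)) := hy.trans_le (min_le_right _ _)
    have h2 : |d| * |y| ≤ (|d| + 1) * |y| := by nlinarith [abs_nonneg d, abs_nonneg y]
    have h3 : (|d| + 1) * |y| < (|d| + 1) * (3 * c * x₀ / (4 * (|d| + 1))) :=
      mul_lt_mul_of_pos_left h1 (by positivity)
    have h4 : (|d| + 1) * (3 * c * x₀ / (4 * (|d| + 1))) = 3 * c / 4 * x₀ := by
      field_simp
    linarith
  -- signs of `f (± x₀, y)` for `y ∈ s`, `|y| < y₁`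
  have hnorm : ∀ {x y : ℝ}, |x| ≤ x₀ → |y| < y₁ → ‖((x, y) : ℝ × ℝ)‖ ≤ x₀ := by
    intro x y hx hy
    rw [Prod.norm_def, Real.norm_eq_abs, Real.norm_eq_abs]
    exact max_le hx (by linarith [hy.le.trans hy₁x₀])
  have hpos : ∀ {y : ℝ}, y ∈ s → |y| < y₁ → 0 < f (x₀, y) := by
    intro y hys hy
    have hn : ‖((x₀, y) : ℝ × ℝ)‖ ≤ x₀ := hnorm (abs_of_pos hx₀).le hy
    have hmem : ((x₀, y) : ℝ × ℝ) ∈ U ×ˢ s :=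
      mk_mem_prod (hIccU ⟨by linarith, le_rfl⟩) hys
    have h := H₁ (x₀, y) (hn.trans_lt hx₀ρ₁) hmem
    have h' : |f (x₀, y) - (c * x₀ + d * y)| ≤ c / 4 * x₀ :=
      h.trans (mul_le_mul_of_nonneg_left hn (by positivity))
    have hdy : |d * y| < 3 * c / 4 * x₀ := by rw [abs_mul]; exact hy₁d hy
    rw [abs_le] at h'
    rw [abs_lt] at hdy
    nlinarith
  have hneg : ∀ {y : ℝ}, y ∈ s → |y| < y₁ → f (-x₀, y) < 0 := by
    intro y hys hy
    have hn : ‖((-x₀, y) : ℝ × ℝ)‖ ≤ x₀ := hnorm (by rw [abs_neg, abs_of_pos hx₀]) hy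
    have hmem : ((-x₀, y) : ℝ × ℝ) ∈ U ×ˢ s :=
      mk_mem_prod (hIccU ⟨le_rfl, by linarith⟩) hys
    have h := H₁ (-x₀, y) (hn.trans_lt hx₀ρ₁) hmem
    have h' : |f (-x₀, y) - (c * -x₀ + d * y)| ≤ c / 4 * x₀ :=
      h.trans (mul_le_mul_of_nonneg_left hn (by positivity))
    have hdy : |d * y| < 3 * c / 4 * x₀ := by rw [abs_mul]; exact hy₁d hy
    rw [abs_le] at h'
    rw [abs_lt] at hdy
    nlinarith
  -- Step 1: the zero `X y ∈ [-x₀, x₀]` of `f (·, y)` (intermediate value theorem), `X 0 = 0`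
  have key : ∀ y : ℝ, ∃ x : ℝ, x ∈ Icc (-x₀) x₀ ∧ (y ∈ s → |y| < y₁ → f (x, y) = 0) ∧
      (y = 0 → x = 0) := by
    intro y
    by_cases hy0 : y = 0
    · exact ⟨0, ⟨by linarith, hx₀.le⟩, fun _ _ ↦ by rw [hy0, h0], fun _ ↦ rfl⟩
    by_cases hy : y ∈ s ∧ |y| < y₁
    · have hcont : ContinuousOn (fun x ↦ f (x, y)) (Icc (-x₀) x₀) :=
        (H₂ y (hy.2.trans_le hy₁ρ₂) hy.1).mono hIccU
      have hivt := intermediate_value_Icc (by linarith : -x₀ ≤ x₀) hcont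
      obtain ⟨x, hxI, hfx⟩ := hivt ⟨(hneg hy.1 hy.2).le, (hpos hy.1 hy.2).le⟩
      exact ⟨x, hxI, fun _ _ ↦ hfx, fun h ↦ (hy0 h).elim⟩
    · exact ⟨0, ⟨by linarith, hx₀.le⟩, fun h1 h2 ↦ (hy ⟨h1, h2⟩).elim, fun h ↦ (hy0 h).elim⟩
  choose X hXI hXf hX0 using key
  have hXabs : ∀ y, |X y| ≤ x₀ := fun y ↦ abs_le.mpr (hXI y)
  have hXU : ∀ y, X y ∈ U := fun y ↦ hIccU (hXI y)
  -- the parameters `y ∈ s`, `|y| < y₁` form a neighbourhood of `0` within `s`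
  have hev : ∀ᶠ y in 𝓝[s] 0, y ∈ s ∧ |y| < y₁ := by
    refine eventually_mem_nhdsWithin.and (eventually_nhdsWithin_of_eventually_nhds ?_)
    rw [Metric.eventually_nhds_iff]
    exact ⟨y₁, hy₁, fun y hy ↦ by simpa using hy⟩
  -- Step 2: `|X y| ≤ C₁ |y|` (the zero is `O(y)`)
  set C₁ := (|d| + c / 4) / (3 * c / 4) with hC₁_def
  have hC₁ : 0 ≤ C₁ := by positivity
  have hXlin : ∀ {y : ℝ}, y ∈ s → |y| < y₁ → |X y| ≤ C₁ * |y| := by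
    intro y hys hy
    have hn : ‖((X y, y) : ℝ × ℝ)‖ ≤ x₀ := hnorm (hXabs y) hy
    have h := H₁ (X y, y) (hn.trans_lt hx₀ρ₁) (mk_mem_prod (hXU y) hys)
    rw [hXf y hys hy, zero_sub, abs_neg] at h
    have hmax : ‖((X y, y) : ℝ × ℝ)‖ ≤ |X y| + |y| := by
      rw [Prod.norm_def, Real.norm_eq_abs, Real.norm_eq_abs]
      exact max_le (le_add_of_nonneg_right (abs_nonneg _)) (le_add_of_nonneg_left (abs_nonneg _))
    have h' : |c * X y + d * y| ≤ c / 4 * (|X y| + |y|) :=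
      h.trans (mul_le_mul_of_nonneg_left hmax (by positivity))
    have htri : c * |X y| ≤ |c * X y + d * y| + |d| * |y| := by
      have := abs_sub (c * X y + d * y) (d * y)
      rw [add_sub_cancel_right, abs_mul, abs_mul, abs_of_pos hx] at this
      linarith
    have h3 : 3 * c / 4 * |X y| ≤ (|d| + c / 4) * |y| := by nlinarith
    rw [hC₁_def, div_mul_eq_mul_div, le_div_iff₀ (by positivity)]
    linarith
  -- `X y → 0` within `s`, hence `(X y, y) → (0, 0)` within `U ×ˢ s`
  have hXtend : Tendsto X (𝓝[s] 0) (𝓝 0) := by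
    have hle : ∀ᶠ y in 𝓝[s] 0, ‖X y‖ ≤ C₁ * |y| :=
      hev.mono fun y hy ↦ (Real.norm_eq_abs _).le.trans (hXlin hy.1 hy.2)
    have hlim : Tendsto (fun y : ℝ ↦ C₁ * |y|) (𝓝[s] 0) (𝓝 0) := by
      have : Tendsto (fun y : ℝ ↦ C₁ * |y|) (𝓝 0) (𝓝 (C₁ * |0|)) :=
        (continuous_const.mul continuous_abs).tendsto 0
      rw [abs_zero, mul_zero] at this
      exact this.mono_left nhdsWithin_le_nhds
    exact squeeze_zero_norm' hle hlim
  have hT : Tendsto (fun y ↦ ((X y, y) : ℝ × ℝ)) (𝓝[s] 0) (𝓝[U ×ˢ s] (0, 0)) := by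
    refine tendsto_nhdsWithin_iff.mpr ⟨hXtend.prodMk_nhds (tendsto_id'.2 nhdsWithin_le_nhds), ?_⟩
    exact eventually_mem_nhdsWithin.mono fun y hy ↦ mk_mem_prod (hXU y) hy
  -- Step 3: `X y = -(d/c) y + o(y)` within `s`
  refine ⟨X, hX0 0 rfl, hXU, hev.mono fun y hy ↦ hXf y hy.1 hy.2, ?_⟩
  rw [hasDerivWithinAt_iff_isLittleO, Asymptotics.isLittleO_iff]
  intro ε hε
  have hε' : 0 < ε * c / (C₁ + 1) := by positivity
  filter_upwards [hev, hT.eventually (hbound hε')] with y hy hb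
  rw [hXf y hy.1 hy.2, zero_sub, abs_neg] at hb
  have hmax : ‖((X y, y) : ℝ × ℝ)‖ ≤ (C₁ + 1) * |y| := by
    rw [Prod.norm_def, Real.norm_eq_abs, Real.norm_eq_abs]
    refine max_le ((hXlin hy.1 hy.2).trans (by nlinarith [abs_nonneg y])) (by nlinarith [abs_nonneg y])
  have hb' : |c * X y + d * y| ≤ ε * c * |y| := by
    refine hb.trans ?_
    have hC1 : C₁ + 1 ≠ 0 := by positivity
    calc ε * c / (C₁ + 1) * ‖((X y, y) : ℝ × ℝ)‖
        ≤ ε * c / (C₁ + 1) * ((C₁ + 1) * |y|) := mul_le_mul_of_nonneg_left hmax hε'.le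
      _ = ε * c * |y| := by field_simp
  have hc0 : c ≠ 0 := hx.ne'
  have hgoal : X y - y * (-d / c) = (c * X y + d * y) / c := by
    field_simp; ring
  rw [hX0 0 rfl]
  simp only [sub_zero, Real.norm_eq_abs, smul_eq_mul]
  rw [hgoal, abs_div, abs_of_pos hx, div_le_iff₀ hx]
  linarith

/-- **Implicit function theorem at a point of differentiability** (general form of
Chodosh–Shlapentokh-Rothman's Thm. 15.1, after Halkin). Let `f : ℝ × ℝ → ℝ` vanish at `(0, 0)`,
let `U` be a neighbourhood of `0` and `s ⊆ ℝ` a set of parameters; assume `x ↦ f (x, y)` is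
continuous on `U` for all `y ∈ s` close to `0`, and `f` is differentiable at `(0, 0)` within
`U ×ˢ s` with `∂ₓf(0, 0) = f' (1, 0) ≠ 0`. Then there is `X : ℝ → ℝ` with `X 0 = 0`, `X y ∈ U`,
`f (X y, y) = 0` for all `y ∈ s` close to `0`, and `X` is differentiable at `0` within `s` with
derivative `−∂_yf(0,0) / ∂ₓf(0,0)`. Chodosh–Shlapentokh-Rothman, CMP 356 (2017), Thm. 15.1 and
its proof (p. 61 of arXiv:1510.08025), citing Halkin, SIAM J. Control 12 (1974) 229–236.
[cite: ChodoshShlapentokhrothman2017, Thm. 15.1] -/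
theorem hasDerivWithinAt_implicitFunction {f : ℝ × ℝ → ℝ} {f' : ℝ × ℝ →L[ℝ] ℝ}
    {U s : Set ℝ} (hU : U ∈ 𝓝 (0 : ℝ))
    (hc : ∀ᶠ y in 𝓝[s] 0, ContinuousOn (fun x ↦ f (x, y)) U)
    (hd : HasFDerivWithinAt f f' (U ×ˢ s) (0, 0)) (h0 : f (0, 0) = 0) (hx : f' (1, 0) ≠ 0) :
    ∃ X : ℝ → ℝ, X 0 = 0 ∧ (∀ y, X y ∈ U) ∧ (∀ᶠ y in 𝓝[s] 0, f (X y, y) = 0) ∧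
      HasDerivWithinAt X (-(f' (0, 1)) / f' (1, 0)) s 0 := by
  rcases lt_or_gt_of_ne hx with hlt | hgt
  · -- negative slope: apply the positive case to `-f`
    have hc' : ∀ᶠ y in 𝓝[s] 0, ContinuousOn (fun x ↦ (-f) (x, y)) U :=
      hc.mono fun y hy ↦ hy.neg
    have hd' : HasFDerivWithinAt (-f) (-f') (U ×ˢ s) (0, 0) := hd.neg
    have h0' : (-f) (0, 0) = 0 := by simp [h0]
    have hx' : 0 < (-f') (1, 0) := by simpa using hlt
    obtain ⟨X, hX0, hXU, hXf, hXd⟩ := hasDerivWithinAt_implicitFunction_of_pos hU hc' hd' h0' hx'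
    refine ⟨X, hX0, hXU, hXf.mono fun y hy ↦ by simpa using hy, ?_⟩
    have key : -((-f') (0, 1)) / (-f') (1, 0) = -(f' (0, 1)) / f' (1, 0) := by
      simp [div_neg, neg_div]
    rwa [key] at hXd
  · exact hasDerivWithinAt_implicitFunction_of_pos hU hc hd h0 hgt

/-- **Chodosh–Shlapentokh-Rothman's Theorem 15.1 (Halkin's implicit function theorem for
Lipschitz functions), as printed.** "Suppose that `f(x, y) : {(x, y) : x ∈ (−1, 1), y ∈ [0, 1)} → ℝ`
is Lipschitz and differentiable at `(0, 0)` with `f(0, 0) = 0` and `∂ₓf(0, 0) ≠ 0`. Then, for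
some `η₀ > 0`, there is a function `X : [0, η₀) → (−1, 1)`, so that `X(0) = 0`, `f(X(y), y) = 0`
for `y ∈ [0, η₀)`, and so that `X` is differentiable at `0`." Here `f` is a function on `ℝ × ℝ`
whose values off the box are irrelevant, differentiability at `(0, 0)` is within the box, and
the (right) derivative of `X` at `0` is identified as `−∂_yf(0,0)/∂ₓf(0,0)`. This is the
implicit function theorem used in CSR §13.4 (pp. 58–59) to make the Klein–Gordon mass constant
along the bifurcating family of Thm. 1.1. Chodosh–Shlapentokh-Rothman, CMP 356 (2017), Thm. 15.1
(p. 61 of arXiv:1510.08025); H. Halkin, SIAM J. Control 12 (1974) 229–236.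
[cite: ChodoshShlapentokhrothman2017, Thm. 15.1] -/
theorem exists_implicitFunction_of_lipschitzOnWith {f : ℝ × ℝ → ℝ} {K : NNReal}
    {f' : ℝ × ℝ →L[ℝ] ℝ} (hf : LipschitzOnWith K f (Ioo (-1) 1 ×ˢ Ico 0 1))
    (hd : HasFDerivWithinAt f f' (Ioo (-1) 1 ×ˢ Ico 0 1) (0, 0)) (h0 : f (0, 0) = 0)
    (hx : f' (1, 0) ≠ 0) :
    ∃ η₀ > 0, ∃ X : ℝ → ℝ, X 0 = 0 ∧ (∀ y ∈ Ico 0 η₀, X y ∈ Ioo (-1) 1 ∧ f (X y, y) = 0) ∧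
      HasDerivWithinAt X (-(f' (0, 1)) / f' (1, 0)) (Ici 0) 0 := by
  have hU : Ioo (-1 : ℝ) 1 ∈ 𝓝 (0 : ℝ) := Ioo_mem_nhds (by norm_num) (by norm_num)
  have hc : ∀ᶠ y in 𝓝[Ico (0 : ℝ) 1] 0, ContinuousOn (fun x ↦ f (x, y)) (Ioo (-1) 1) := by
    refine eventually_nhdsWithin_of_forall fun y hy ↦ ?_
    have h2 : ContinuousOn (fun x : ℝ ↦ ((x, y) : ℝ × ℝ)) (Ioo (-1) 1) := by fun_prop
    exact hf.continuousOn.comp h2 fun x hx ↦ mk_mem_prod hx hy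
  obtain ⟨X, hX0, hXU, hXf, hXd⟩ := hasDerivWithinAt_implicitFunction hU hc hd h0 hx
  rw [nhdsWithin_Ico_eq_nhdsGE (zero_lt_one' ℝ)] at hXf
  obtain ⟨η₀, hη₀, hη⟩ := mem_nhdsGE_iff_exists_Ico_subset.mp hXf
  exact ⟨η₀, hη₀, X, hX0, fun y hy ↦ ⟨hXU y, hη hy⟩,
    hXd.mono_of_mem_nhdsWithin (Ico_mem_nhdsGE zero_lt_one)⟩

/-- The printed conclusion "`X` is differentiable at `0`" (one-sidedly, on `[0, η₀)`), as a
corollary of `exists_implicitFunction_of_lipschitzOnWith`. Chodosh–Shlapentokh-Rothman, CMP 356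
(2017), Thm. 15.1. [cite: ChodoshShlapentokhrothman2017, Thm. 15.1] -/
theorem exists_implicitFunction_differentiableWithinAt {f : ℝ × ℝ → ℝ} {K : NNReal}
    {f' : ℝ × ℝ →L[ℝ] ℝ} (hf : LipschitzOnWith K f (Ioo (-1) 1 ×ˢ Ico 0 1))
    (hd : HasFDerivWithinAt f f' (Ioo (-1) 1 ×ˢ Ico 0 1) (0, 0)) (h0 : f (0, 0) = 0)
    (hx : f' (1, 0) ≠ 0) :
    ∃ η₀ > 0, ∃ X : ℝ → ℝ, X 0 = 0 ∧ (∀ y ∈ Ico 0 η₀, X y ∈ Ioo (-1) 1 ∧ f (X y, y) = 0) ∧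
      DifferentiableWithinAt ℝ X (Ico 0 η₀) 0 := by
  obtain ⟨η₀, hη₀, X, hX0, hX, hXd⟩ := exists_implicitFunction_of_lipschitzOnWith hf hd h0 hx
  exact ⟨η₀, hη₀, X, hX0, hX, (hXd.mono Ico_subset_Ici_self).differentiableWithinAt⟩

end Literature.Analysis.Calculus
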